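import Summits.QuantumFields.BalabanUV.T4Continuum.Support.SmallFieldDomains

/-!
# T⁴ programme, SUBSTRATE — `Support/SmallFieldDomainsTower`: the CANONICAL CONSTRUCTOR of big-block domain sequences — the
# deep cube core `coreCubes s r X` and the tower `Ω_{j+1} := coreCubes (M₁L^{j+1}) (R·M₁·L^j) (Ω_j ∖ bad_j)` built from ANY
# sequence of «bad» (large-field) sets, with `BigDomainSeq` PROVED for it

Audit cell `pub-balaban`, SUBSTRATE cell seat p4 (focus «small/large-field region bookkeeping»); companion of `Support/SmallFieldDomains`
(`BigDomainSeq`, `ptIndex`, `layer`; same namespace).  Purpose: every history of large-field sets (e.g. the block-coarsened `observed`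
outcomes of `Support/SubstrateLargeFieldNestedSharp`) yields an ADMISSIBLE domain sequence — so the point index, the class cubes and
coverings (`…Cubes`, `…Cover`), the weighted norms (`…Norms`) and the index map of `RegularBackgroundLocal.RegularTransportersLocal` all
apply to it — WITHOUT committing to Bałaban's exact construction rule ([Balaban1988Convergent] (1.10) p. 248 *"Denote Ω₁ = (Q₁′~² ∪
(B(P₁¹)ᶜ)~³)ᶜ … thus Ω₁ is a union of LMR₁-cubes, and a distance between Ω₁ and the union of the large field regions is at least
2LMR₁"*; [Balaban1989LargeFieldI] (1.3)–(1.9)), whose sets are INSTANCES (any union of big cubes lying deep enough is below the canonical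
core: `subset_coreCubes_iff`).

WHAT THIS FILE PROVIDES (all `[folklore]`):
 * §1 `coreCubes s r X` = the points whose whole side-`s` cube has its sup-`r`-neighbourhood inside `X`: a union of `s`-cubes
   (`isUnionOfCubes_coreCubes`), inside `X` (`coreCubes_subset`, `r ≥ 0`), `r`-deep (`coreCubes_deep`), monotone in `X`, antitone in
   `r`, and MAXIMAL: a union of `s`-cubes `Y` lies in `coreCubes s r X` iff its `r`-neighbourhood lies in `X` (`subset_coreCubes_iff`);
 * §2 the tower `domainTower L M₁ R Ω₀ bad` (`Ω 0 = Ω₀`, `Ω (j+1) = coreCubes (M₁L^{j+1}) (R·M₁·L^j) (Ω j ∖ bad j)`), its truncation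
   `truncTower k`, and **`bigDomainSeq_truncTower`**: for `Ω₀` a union of `M₁`-cubes the truncated tower IS a `BigDomainSeq L M₁ R k`;
   `domainTower_succ_subset`, **`domainTower_succ_far_bad`** (the `R·M₁·L^j`-neighbourhood of `Ω_{j+1}` misses `bad j` — the typed
   form of *"a distance between Ω₁ and the union of the large field regions is at least …"*), `not_mem_bad_of_mem_succ`.
HONEST FRAMING (T4-DAG p. 1).  Set algebra on `ℤ^d`; no configuration, no estimate; the canonical core is OURS (a universal construction),
Bałaban's printed sets are not asserted to equal it (they are instances when deep enough).  NOT an estimate of any NE row; spine 0/9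
unchanged; NOT infinite volume, NOT a mass gap, NOT Clay.  HONEST DEPENDENCY: continuum YM on T⁴ ⇐ BetaPertH ∧ nine spine estimates (0/9
proved); BetaPertH ⇐ (D1) ∧ (D4) ∧ CAP+tail; G-an2-4 gates asym, D1 and NE2/3/4.  No `sorry`.
-/

noncomputable section

namespace Summit.QuantumFields.BalabanUV.T4Continuum.SmallFieldDomains

open Literature.MathematicalPhysics.QuantumFieldTheory.Balaban1983to89.B14DomainGeom

variable {d : ℕ}

/-! ## §1 The deep cube core -/

/-- The DEEP CUBE CORE of `X` for side `s` and radius `r`: the points `x` such that every point `y` of the side-`s` cube of `x` has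
its whole sup-ball of radius `r` inside `X`.  (The canonical «union of big cubes at distance `≥ r` from `Xᶜ`».) [folklore] -/
def coreCubes (s : ℕ) (r : ℤ) (X : Set (Pt d)) : Set (Pt d) :=
  {x | ∀ y, cubeIdx s y = cubeIdx s x → ∀ z, Within r y z → z ∈ X}

/-- Membership, unfolded. [folklore] -/
theorem mem_coreCubes {s : ℕ} {r : ℤ} {X : Set (Pt d)} {x : Pt d} :
    x ∈ coreCubes s r X ↔ ∀ y, cubeIdx s y = cubeIdx s x → ∀ z, Within r y z → z ∈ X := Iff.rfl

/-- The core is a union of side-`s` cubes (membership depends on the cube index only). [folklore] -/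
theorem isUnionOfCubes_coreCubes (s : ℕ) (r : ℤ) (X : Set (Pt d)) : IsUnionOfCubes s (coreCubes s r X) := by
  intro x x' hxx'
  simp only [mem_coreCubes, hxx']

/-- The core is `r`-DEEP in `X`: the sup-ball of radius `r` about a core point lies in `X`. [folklore] -/
theorem coreCubes_deep {s : ℕ} {r : ℤ} {X : Set (Pt d)} {x : Pt d} (hx : x ∈ coreCubes s r X) {z : Pt d} (hz : Within r x z) :
    z ∈ X :=
  hx x rfl z hz

/-- The core lies in `X` (`r ≥ 0`). [folklore] -/
theorem coreCubes_subset {s : ℕ} {r : ℤ} (hr : 0 ≤ r) (X : Set (Pt d)) : coreCubes s r X ⊆ X :=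
  fun x hx => coreCubes_deep hx (Within.refl hr x)

/-- The whole cube of a core point lies in `X` (`r ≥ 0`). [folklore] -/
theorem mem_of_cubeIdx_eq_of_mem_coreCubes {s : ℕ} {r : ℤ} (hr : 0 ≤ r) {X : Set (Pt d)} {x y : Pt d}
    (hx : x ∈ coreCubes s r X) (hy : cubeIdx s y = cubeIdx s x) : y ∈ X :=
  hx y hy y (Within.refl hr y)

/-- Monotone in the set. [folklore] -/
theorem coreCubes_mono (s : ℕ) (r : ℤ) {X Y : Set (Pt d)} (h : X ⊆ Y) : coreCubes s r X ⊆ coreCubes s r Y :=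
  fun _ hx y hy z hz => h (hx y hy z hz)

/-- Antitone in the radius. [folklore] -/
theorem coreCubes_anti_radius (s : ℕ) {r r' : ℤ} (h : r ≤ r') (X : Set (Pt d)) : coreCubes s r' X ⊆ coreCubes s r X :=
  fun _ hx y hy z hz => hx y hy z (hz.mono h)

/-- **MAXIMALITY**: a union of side-`s` cubes `Y` lies in the core iff the `r`-neighbourhood of `Y` lies in `X`.  (So ANY printed
small-field region that is a union of big cubes at sup-distance `≥ r` from the removed set is contained in the canonical one.)
[folklore] -/
theorem subset_coreCubes_iff {s : ℕ} {r : ℤ} {X Y : Set (Pt d)} (hY : IsUnionOfCubes s Y) :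
    Y ⊆ coreCubes s r X ↔ ∀ y ∈ Y, ∀ z, Within r y z → z ∈ X := by
  constructor
  · intro h y hy z hz
    exact coreCubes_deep (h hy) hz
  · intro h x hx y hyx z hz
    exact h y ((hY y x hyx).mpr hx) z hz

/-- The core of the whole lattice is the whole lattice. [folklore] -/
theorem coreCubes_univ (s : ℕ) (r : ℤ) : coreCubes s r (Set.univ : Set (Pt d)) = Set.univ :=
  Set.eq_univ_of_forall fun _ _ _ _ _ => Set.mem_univ _

/-- The core of the empty set is empty (`r ≥ 0`). [folklore] -/
theorem coreCubes_empty (s : ℕ) {r : ℤ} (hr : 0 ≤ r) : coreCubes s r (∅ : Set (Pt d)) = ∅ :=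
  Set.eq_empty_of_subset_empty (coreCubes_subset hr ∅)

/-! ## §2 The domain tower built from a sequence of bad sets -/

/-- **THE DOMAIN TOWER** from an initial domain `Ω₀` and a sequence of «bad» sets (`bad j` = the large-field region found at level
`j`, in fine-lattice points): `Ω 0 = Ω₀`, `Ω (j+1) = coreCubes (M₁L^{j+1}) (R·M₁·L^j) (Ω j ∖ bad j)` — remove the bad set, then keep
the union of the level-`(j+1)` big cubes lying `R·M₁·L^j`-deep in what is left. [folklore] -/
def domainTower (L M₁ R : ℕ) (Ω₀ : Set (Pt d)) (bad : ℕ → Set (Pt d)) : ℕ → Set (Pt d)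
  | 0 => Ω₀
  | j + 1 => coreCubes (M₁ * L ^ (j + 1)) ((R : ℤ) * M₁ * L ^ j) (domainTower L M₁ R Ω₀ bad j \ bad j)

section Tower
variable (L M₁ R : ℕ) (Ω₀ : Set (Pt d)) (bad : ℕ → Set (Pt d))

/-- Level `0`. [folklore] -/
@[simp] theorem domainTower_zero : domainTower L M₁ R Ω₀ bad 0 = Ω₀ := rfl

/-- The successor level, unfolded. [folklore] -/
theorem domainTower_succ (j : ℕ) :
    domainTower L M₁ R Ω₀ bad (j + 1) =
      coreCubes (M₁ * L ^ (j + 1)) ((R : ℤ) * M₁ * L ^ j) (domainTower L M₁ R Ω₀ bad j \ bad j) := rfl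

/-- NESTING: `Ω_{j+1} ⊆ Ω_j ∖ bad_j ⊆ Ω_j`. [folklore] -/
theorem domainTower_succ_subset_sdiff (j : ℕ) :
    domainTower L M₁ R Ω₀ bad (j + 1) ⊆ domainTower L M₁ R Ω₀ bad j \ bad j := by
  rw [domainTower_succ]
  exact coreCubes_subset (by positivity) _

/-- `Ω_{j+1} ⊆ Ω_j`. [folklore] -/
theorem domainTower_succ_subset (j : ℕ) : domainTower L M₁ R Ω₀ bad (j + 1) ⊆ domainTower L M₁ R Ω₀ bad j :=
  (domainTower_succ_subset_sdiff L M₁ R Ω₀ bad j).trans Set.sdiff_subset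

/-- A point of `Ω_{j+1}` is not bad at level `j`. [folklore] -/
theorem not_mem_bad_of_mem_succ {j : ℕ} {x : Pt d} (hx : x ∈ domainTower L M₁ R Ω₀ bad (j + 1)) : x ∉ bad j :=
  ((domainTower_succ_subset_sdiff L M₁ R Ω₀ bad j) hx).2

/-- **SEPARATION FROM THE BAD SET**: the sup-ball of radius `R·M₁·L^j` about a point of `Ω_{j+1}` lies in `Ω_j` AND misses `bad_j`
(the typed form of *"a distance between Ω₁ and the union of the large field regions is at least …"*). [folklore] -/
theorem domainTower_succ_far_bad {j : ℕ} {x : Pt d} (hx : x ∈ domainTower L M₁ R Ω₀ bad (j + 1)) {z : Pt d}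
    (hz : Within ((R : ℤ) * M₁ * L ^ j) x z) : z ∈ domainTower L M₁ R Ω₀ bad j ∧ z ∉ bad j := by
  rw [domainTower_succ] at hx
  exact coreCubes_deep hx hz

/-- Every positive level is a union of `M₁L^j`-cubes. [folklore] -/
theorem isUnionOfCubes_domainTower_succ (j : ℕ) :
    IsUnionOfCubes (M₁ * L ^ (j + 1)) (domainTower L M₁ R Ω₀ bad (j + 1)) := by
  rw [domainTower_succ]; exact isUnionOfCubes_coreCubes _ _ _

/-- The TRUNCATED tower: the levels `≤ k`, empty above. [folklore] -/
def truncTower (k : ℕ) : ℕ → Set (Pt d) := fun j => if j ≤ k then domainTower L M₁ R Ω₀ bad j else ∅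

/-- Levels `≤ k` of the truncation are the tower's. [folklore] -/
theorem truncTower_of_le {k j : ℕ} (h : j ≤ k) : truncTower L M₁ R Ω₀ bad k j = domainTower L M₁ R Ω₀ bad j := by
  simp [truncTower, h]

/-- Levels `> k` of the truncation are empty. [folklore] -/
theorem truncTower_of_lt {k j : ℕ} (h : k < j) : truncTower L M₁ R Ω₀ bad k j = ∅ := by
  simp [truncTower, Nat.not_le.mpr h]

/-- **THE TRUNCATED TOWER IS A BIG-BLOCK DOMAIN SEQUENCE** (B8 (1.3)–(1.4) with the printed radii), for `Ω₀` a union of `M₁`-cubes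
(e.g. `Ω₀ = T`). [folklore] -/
theorem bigDomainSeq_truncTower (hΩ₀ : IsUnionOfCubes M₁ Ω₀) (k : ℕ) : BigDomainSeq L M₁ R k (truncTower L M₁ R Ω₀ bad k) where
  anti j := by
    intro x hx
    by_cases h : j + 1 ≤ k
    · rw [truncTower_of_le _ _ _ _ _ h] at hx
      rw [truncTower_of_le _ _ _ _ _ (by omega)]
      exact domainTower_succ_subset L M₁ R Ω₀ bad j hx
    · rw [truncTower_of_lt _ _ _ _ _ (by omega)] at hx
      exact hx.elim
  cubes j := by
    by_cases h : j ≤ k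
    · rw [truncTower_of_le _ _ _ _ _ h]
      rcases j with _ | j
      · simpa using hΩ₀
      · exact isUnionOfCubes_domainTower_succ L M₁ R Ω₀ bad j
    · rw [truncTower_of_lt _ _ _ _ _ (by omega)]
      exact isUnionOfCubes_empty _
  sep j x hx y hy := by
    by_cases h : j + 1 ≤ k
    · rw [truncTower_of_le _ _ _ _ _ h] at hx
      rw [truncTower_of_le _ _ _ _ _ (by omega)]
      exact (domainTower_succ_far_bad L M₁ R Ω₀ bad hx hy).1
    · rw [truncTower_of_lt _ _ _ _ _ (by omega)] at hx
      exact hx.elim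
  above j hj := truncTower_of_lt _ _ _ _ _ hj

/-- The whole-lattice start `Ω₀ = T` qualifies. [folklore] -/
theorem bigDomainSeq_truncTower_univ (k : ℕ) : BigDomainSeq L M₁ R k (truncTower L M₁ R (Set.univ : Set (Pt d)) bad k) :=
  bigDomainSeq_truncTower L M₁ R _ bad (isUnionOfCubes_univ M₁) k

/-- With no bad sets at all and `Ω₀ = T`, every level of the tower is the whole lattice. [folklore] -/
theorem domainTower_univ_of_bad_empty (hbad : ∀ j, bad j = ∅) (j : ℕ) :
    domainTower L M₁ R (Set.univ : Set (Pt d)) bad j = Set.univ := by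
  induction j with
  | zero => rfl
  | succ j ih => rw [domainTower_succ, ih, hbad, Set.sdiff_empty, coreCubes_univ]

end Tower

end Summit.QuantumFields.BalabanUV.T4Continuum.SmallFieldDomains
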